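import Literature.Algebra.Homology.LefschetzNumber
import Literature.Algebra.Homology.EulerCharacteristicShortExact
import HarnessLib

/-!
# Additivity of traces and of the Lefschetz number along a short exact sequence of complexes

Layer `Literature/Algebra/Homology` (pure linear algebra over Mathlib; proved theorems only, 0 definitions, 0 named facts, no
instances, no notation). For a short exact sequence `0 → X₁ → X₂ → X₃ → 0` (Mathlib `ShortComplex`, `ShortExact`) carrying an
ENDOMORPHISM (`ψ : S ⟶ S`, resp. `τ : S ⟶ S`) over a field `K`:

* vector spaces (`S : ShortComplex (ModuleCat K)`, `X₂` finite-dimensional): `trace_restrict_range_g_eq` (`g` onto ⇒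
  `tr(ψ.τ₃ | range g) = tr ψ.τ₃`), `trace_restrict_range_f_eq` (`f` injective ⇒ `tr(ψ.τ₂ | range f) = tr ψ.τ₁`, transport
  along `X₁ ≃ range f`) and **`trace_τ₂_eq_add_of_shortExact : tr ψ.τ₂ = tr ψ.τ₁ + tr ψ.τ₃`** — obtained BY NAME from row
  `TraceHomologyShortComplex`'s `HopfTrace.trace_τ₂_eq` (`tr τ₂ = tr H(ψ) + tr(τ₃ | range g) + tr(τ₂ | range f)`, itself two
  uses of the tree's `Literature.Algebra.Lie.trace_eq_trace_restrict_add_trace_mapQ`) with `H = 0` by exactness; the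
  submodule / quotient identity is not re-derived here;
* complexes (`S : ShortComplex (HomologicalComplex (ModuleCat K) c)`, any shape `c`): degreewise `trace_f_X₂_eq_add`, the signed
  sums `finsum_χ_smul_trace_f_X₂_eq_add` (`X₁`, `X₃` degreewise finite-dimensional with finitely many non-zero terms), and
  **`lefschetzNumber_X₂_eq_add : Λ(τ.τ₂) = Λ(τ.τ₁) + Λ(τ.τ₃)`** for row `LefschetzNumber`'s `lefschetzNumber` (Hopf ×3), with the
  rearrangements `lefschetzNumber_X₁_eq_sub` / `lefschetzNumber_X₃_eq_sub`.

With `τ = 𝟙` this is row `EulerCharacteristicShortExact`'s `eulerChar_X₂_eq_add` (`tr 𝟙 = dim`), not restated.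
Library only (cell `pub-hodge-ring2`, count-neutral); proves nothing about any crux, route or conjecture.

## References

* E. H. Spanier, *Algebraic Topology* (1981), Ch. 4 §7: additivity of traces along exact sequences with an endomorphism and the
  Lefschetz number of a chain map. [Spanier1981]
* A. Hatcher, *Algebraic Topology* (2002), §2.C (Lefschetz number; proof of Thm. 2C.3). [HatcherAT2002]
-/

open CategoryTheory CategoryTheory.Limits

universe v u w

namespace Literature.Algebra.Homology.Lefschetz

variable {K : Type u} [Field K]

/-! ### Vector spaces: an endomorphism of a short exact sequence -/

section ModuleCat

variable {S : ShortComplex (ModuleCat.{v} K)} (ψ : S ⟶ S)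

/-- If `g` is onto, `tr(ψ.τ₃ | range g) = tr ψ.τ₃` (transport along `range g = ⊤ ≃ X₃`).
[cite: Spanier1981, Ch. 4 §7] -/
theorem trace_restrict_range_g_eq (hg : Function.Surjective S.g.hom) :
    LinearMap.trace K _ (ψ.τ₃.hom.restrict (HopfTrace.mapsTo_range_g S ψ)) = LinearMap.trace K S.X₃ ψ.τ₃.hom := by
  have htop : LinearMap.range S.g.hom = ⊤ := LinearMap.range_eq_top.2 hg
  rw [← LinearMap.trace_conj' ψ.τ₃.hom (LinearEquiv.ofTop _ htop).symm]
  congr 1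

/-- If `f` is injective, `tr(ψ.τ₂ | range f) = tr ψ.τ₁` (transport along `X₁ ≃ range f`, `f ∘ τ₁ = τ₂ ∘ f`).
[cite: Spanier1981, Ch. 4 §7] -/
theorem trace_restrict_range_f_eq (hf : Function.Injective S.f.hom) :
    LinearMap.trace K _ (ψ.τ₂.hom.restrict (HopfTrace.mapsTo_range_f S ψ)) = LinearMap.trace K S.X₁ ψ.τ₁.hom := by
  rw [← LinearMap.trace_conj' ψ.τ₁.hom (LinearEquiv.ofInjective S.f.hom hf)]
  congr 1
  apply LinearMap.ext
  intro y
  obtain ⟨x, rfl⟩ := (LinearEquiv.ofInjective S.f.hom hf).surjective y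
  apply Subtype.ext
  rw [LinearMap.coe_restrict_apply, LinearEquiv.conj_apply, LinearMap.comp_apply, LinearMap.comp_apply,
    LinearEquiv.coe_coe, LinearEquiv.coe_coe, LinearEquiv.symm_apply_apply, LinearEquiv.ofInjective_apply,
    LinearEquiv.ofInjective_apply, HopfTrace.f_τ₁_apply]

/-- **Additivity of the trace along a short exact sequence with an endomorphism**: `tr ψ.τ₂ = tr ψ.τ₁ + tr ψ.τ₃`
(`X₂` finite-dimensional). From row `TraceHomologyShortComplex`'s `trace_τ₂_eq` with `H(S) = 0`.
[cite: Spanier1981, Ch. 4 §7] [cite: HatcherAT2002, §2.C] -/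
theorem trace_τ₂_eq_add_of_shortExact (hS : S.ShortExact) [Module.Finite K S.X₂] :
    LinearMap.trace K S.X₂ ψ.τ₂.hom = LinearMap.trace K S.X₁ ψ.τ₁.hom + LinearMap.trace K S.X₃ ψ.τ₃.hom := by
  haveI : Subsingleton S.homology := ModuleCat.subsingleton_of_isZero (S.exact_iff_isZero_homology.1 hS.exact)
  rw [HopfTrace.trace_τ₂_eq S ψ, Subsingleton.elim (ShortComplex.homologyMap ψ).hom 0, map_zero, zero_add,
    trace_restrict_range_g_eq ψ ((ModuleCat.epi_iff_surjective _).1 hS.epi_g),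
    trace_restrict_range_f_eq ψ ((ModuleCat.mono_iff_injective _).1 hS.mono_f), add_comm]

end ModuleCat

/-! ### Complexes: an endomorphism of a short exact sequence of complexes -/

variable {ι : Type w} {c : ComplexShape ι} {S : ShortComplex (HomologicalComplex (ModuleCat.{v} K) c)}
  (hS : S.ShortExact) (τ : S ⟶ S)
include hS

/-- Degreewise `tr(τ₂ⁱ) = tr(τ₁ⁱ) + tr(τ₃ⁱ)` (`X₂ⁱ` finite-dimensional), on the degree-`i` short exact sequence
`S.map (eval i)`. [cite: Spanier1981, Ch. 4 §7] -/
theorem trace_f_X₂_eq_add (i : ι) [Module.Finite K (S.X₂.X i)] :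
    LinearMap.trace K (S.X₂.X i) (τ.τ₂.f i).hom =
      LinearMap.trace K (S.X₁.X i) (τ.τ₁.f i).hom + LinearMap.trace K (S.X₃.X i) (τ.τ₃.f i).hom :=
  haveI : Module.Finite K ((HomologicalComplex.eval (ModuleCat.{v} K) c i).mapShortComplex.obj S).X₂ :=
    inferInstanceAs (Module.Finite K (S.X₂.X i))
  trace_τ₂_eq_add_of_shortExact ((HomologicalComplex.eval (ModuleCat.{v} K) c i).mapShortComplex.map τ)
    (hS.map_of_exact (HomologicalComplex.eval _ _ i))

/-- **Signed trace additivity**: `Σᶠ χ(i)•tr(τ₂ⁱ) = Σᶠ χ(i)•tr(τ₁ⁱ) + Σᶠ χ(i)•tr(τ₃ⁱ)` when `X₁`, `X₃` are degreewise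
finite-dimensional with finitely many non-zero terms. [cite: Spanier1981, Ch. 4 §7] [cite: HatcherAT2002, §2.C] -/
theorem finsum_χ_smul_trace_f_X₂_eq_add [c.EulerCharSigns] [∀ i, Module.Finite K (S.X₁.X i)]
    [∀ i, Module.Finite K (S.X₃.X i)] (h₁ : (GradedObject.finrankSupport S.X₁.X).Finite)
    (h₃ : (GradedObject.finrankSupport S.X₃.X).Finite) :
    ∑ᶠ i, (c.χ i : ℤ) • LinearMap.trace K (S.X₂.X i) (τ.τ₂.f i).hom =
      ∑ᶠ i, (c.χ i : ℤ) • LinearMap.trace K (S.X₁.X i) (τ.τ₁.f i).hom +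
        ∑ᶠ i, (c.χ i : ℤ) • LinearMap.trace K (S.X₃.X i) (τ.τ₃.f i).hom := by
  haveI : ∀ i, Module.Finite K (S.X₂.X i) := fun i => EulerCharShortExact.moduleFinite_X_X₂ hS i
  rw [← finsum_add_distrib
    (HopfTrace.hasFiniteSupport_of_subsingleton S.X₁ h₁ _ fun i _ => by
      rw [Subsingleton.elim (τ.τ₁.f i).hom 0, map_zero, smul_zero])
    (HopfTrace.hasFiniteSupport_of_subsingleton S.X₃ h₃ _ fun i _ => by
      rw [Subsingleton.elim (τ.τ₃.f i).hom 0, map_zero, smul_zero])]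
  exact finsum_congr fun i => by rw [trace_f_X₂_eq_add hS τ i, smul_add]

/-- **Additivity of the Lefschetz number along a short exact sequence of complexes**: `Λ(τ₂) = Λ(τ₁) + Λ(τ₃)` for an
endomorphism `τ` of `0 → X₁ → X₂ → X₃ → 0`, `X₁`, `X₃` degreewise finite-dimensional with finitely many non-zero terms
(Hopf on each term, then signed trace additivity). With `τ = 𝟙`: row `EulerCharacteristicShortExact`.
[cite: Spanier1981, Ch. 4 §7] [cite: HatcherAT2002, §2.C] -/
theorem lefschetzNumber_X₂_eq_add [c.EulerCharSigns] [∀ i, Module.Finite K (S.X₁.X i)]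
    [∀ i, Module.Finite K (S.X₃.X i)] (h₁ : (GradedObject.finrankSupport S.X₁.X).Finite)
    (h₃ : (GradedObject.finrankSupport S.X₃.X).Finite) :
    lefschetzNumber τ.τ₂ = lefschetzNumber τ.τ₁ + lefschetzNumber τ.τ₃ := by
  haveI : ∀ i, Module.Finite K (S.X₂.X i) := fun i => EulerCharShortExact.moduleFinite_X_X₂ hS i
  have h₂ : (GradedObject.finrankSupport S.X₂.X).Finite :=
    (h₁.union h₃).subset (EulerCharShortExact.finrankSupport_X₂_subset hS)
  rw [lefschetzNumber_eq_finsum_χ_smul_trace_f τ.τ₂ h₂, lefschetzNumber_eq_finsum_χ_smul_trace_f τ.τ₁ h₁,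
    lefschetzNumber_eq_finsum_χ_smul_trace_f τ.τ₃ h₃, finsum_χ_smul_trace_f_X₂_eq_add hS τ h₁ h₃]

/-- `Λ(τ₁) = Λ(τ₂) − Λ(τ₃)` (the Lefschetz number of the endomorphism induced on a stable subcomplex).
[cite: Spanier1981, Ch. 4 §7] -/
theorem lefschetzNumber_X₁_eq_sub [c.EulerCharSigns] [∀ i, Module.Finite K (S.X₁.X i)]
    [∀ i, Module.Finite K (S.X₃.X i)] (h₁ : (GradedObject.finrankSupport S.X₁.X).Finite)
    (h₃ : (GradedObject.finrankSupport S.X₃.X).Finite) :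
    lefschetzNumber τ.τ₁ = lefschetzNumber τ.τ₂ - lefschetzNumber τ.τ₃ := by
  rw [lefschetzNumber_X₂_eq_add hS τ h₁ h₃, add_sub_cancel_right]

/-- `Λ(τ₃) = Λ(τ₂) − Λ(τ₁)` (the Lefschetz number of the endomorphism induced on the quotient complex).
[cite: Spanier1981, Ch. 4 §7] -/
theorem lefschetzNumber_X₃_eq_sub [c.EulerCharSigns] [∀ i, Module.Finite K (S.X₁.X i)]
    [∀ i, Module.Finite K (S.X₃.X i)] (h₁ : (GradedObject.finrankSupport S.X₁.X).Finite)
    (h₃ : (GradedObject.finrankSupport S.X₃.X).Finite) :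
    lefschetzNumber τ.τ₃ = lefschetzNumber τ.τ₂ - lefschetzNumber τ.τ₁ := by
  rw [lefschetzNumber_X₂_eq_add hS τ h₁ h₃, add_sub_cancel_left]

end Literature.Algebra.Homology.Lefschetz
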